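import Literature.NumberTheory.Rogawski1990.ArchBouazizClassMapG            -- ★-to-be (7) F0, LH3-p04 (g7): `bzClassG` (charpoly coefficients of the place component), `bzClassG_conj`, `bzClassG_gprimeTorus = bzClassMapG`, `bzClassMapG`, `esymm3`
import Literature.NumberTheory.Rogawski1990.ArchStableSumG                  -- ★ p851904 LH10-p02 (g9), N8-INNER (2): `stableSumG`, `stableTwistG`, `slotPerm`, `partnerPerms`, `slotPerm_mem_regG_iff`
import Literature.NumberTheory.Rogawski1990.ArchHCOrbitalFamilyGExt          -- ★ LH3-p02: `orbFamGExt`, `orbFamGExt_of_mem_regG`; brings ★ `orbFamG`, `orbFamG_apply ∕ _of_not`, ★ `chartOrbG_def`, `forall_mem_chartTorusG_comm`, `RegG`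
import Literature.NumberTheory.Rogawski1990.ArchSmoothAmbientLift            -- ★ `exists_contDiff_hasCompactSupport_of_isArchSmooth` (ambient `C^∞` lift of an `IsArchSmooth` witness); brings ★ `ArchSmooth`
import Literature.NumberTheory.Rogawski1990.ArchEndoscopicProductTestFunction -- ★ (N1) §1: `contDiff_apply_snd_apply` (the complex coordinates of `M₃(L ⊗ ℝ)` are `C^∞`)
import Literature.NumberTheory.Automorphic.ArchStableConjugacyLocalGlobal     -- ★ (g1): `coe_archPiEquivCM_apply` (place components = `GL₃(evalC w)`, definitional)
import Literature.LinearAlgebra.Matrix.CubicDiscriminantDiagonalScaling      -- ★ `charpoly_fin_three_explicit` (`X³ − e₁X² + e₂X − e₃` for a `3 × 3` matrix; Mathlib-only module)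
import HarnessLib

/-!
# The CLASS-FUNCTION MULTIPLIER on `G′_∞ = U(diag α)(L⁺ ⊗ ℝ)`: `a′ ↦ (F ∘ cl_G) · a′` preserves `C_c^∞(G′_∞)` and multiplies every chart orbital functional by the
# value of `F` at the class of the chart point (Bouaziz 1994 §2.3, §5.1; Varadarajan 1989 §6.4 Thms. 22–23) — the `G′`-twin of ★ `ArchBouazizClassMultiplier`

Topic `NumberTheory/Rogawski1990`; namespace `Literature.NumberTheory.Rogawski1990`.  Theorems only (no definition, no instance, no notation, no axiom, no named fact, no
`sorry`).  Cell `pub/hodgecm-mathlib`, crux H413 (`stmt-HodgeConjecture-24833`), line LH2 (closer stub `stub_N8`, organ (Sh)′ «inner archimedean transfer»), N8-INNER road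
(dealer LH2-plan (g1), DEAL #1 2026-09-02T15:34:48Z, RULING (7) 15:59:55Z), brick **(7) «(Σ-REG-G)»** (owner LH3-p04 (g7), CENSUS-SigmaRegG v1.1 §5 (c)), file **F4
`ArchBouazizClassMultiplierG`** over the owner's F0 ★ `ArchBouazizClassMapG` (`bzClassG L α g w = (σ₁, σ₂, σ₃)` = the signed coefficients of the characteristic polynomial of the
place component; `bzClassG_conj`; `bzClassG_gprimeTorus : bzClassG L α (gprimeTorus L α S′ c) = bzClassMapG S′ c`).  Author F0P3a-p04 (g27), heir of the author of the `H`-side twin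
★ `ArchBouazizClassMultiplier` (p851490).  Count-neutral.

THE POINT.  Local surjectivity of `a′ ↦ (orbFamGExt L α ν′ a′ S′)_{S′}` onto the Harish-Chandra space of the `G′`-atlas near a REGULAR base class is proved — exactly as on
`H_∞` (★ `bzLocalSurjRegular_of_parts`, p851525) — by the «class-function multiplier» road: ONE test function whose family does not vanish near the base class, multiplied by a
smooth CLASS function `F ∘ cl_G` (`cl_G = bzClassG L α : G′_∞ → (W → ℂ × ℂ × ℂ)`, constant on stable classes), has family `(F ∘ bzClassMapG S′) · family` on every chart.  This file
is the multiplier half.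
* §1 the principal-minor sum `e₂` of a `3 × 3` matrix: `two_mul_bzMinorSum` (`2e₂ = (tr A)² − tr(A²)`, Newton), `bzMinorSum_units_conj`, and Vieta in the form this file needs:
  **`bzClassG_eq_trace_minorSum_det`**: the owner's
  `bzClassG L α g w = (−coeff₂, coeff₁, −coeff₀)(charpoly A_w)` IS the ENTRY POLYNOMIAL `(tr A_w, e₂ A_w, det A_w)` (★ `charpoly_fin_three_explicit`) — the form in which the class
  map is visibly smooth on the ambient matrix space; `snd_coe_coe_apply` (entries of `A_w` = `w`-coordinates of the entries of `g ∈ GL₃(L ⊗ ℝ)`, ★ `coe_archPiEquivCM_apply`),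
  `continuous_bzClassG`, `bzClassG_eq_of_isConj`.
* §4 **`ArchSmooth.classMul`**: `ArchSmooth L 3 (diag α) a′ → ArchSmooth L 3 (diag α) (fun k => F (bzClassG L α k) * a′ k)` for `F : (W → ℂ × ℂ × ℂ) → ℂ` of class `C^∞` — the
  ambient witness is `(F ∘ cl_amb) · Θ` with `Θ` the `C^∞` lift of ★ `exists_contDiff_hasCompactSupport_of_isArchSmooth` and `cl_amb` the entry polynomials `(tr, e₂, det)` on
  `M₃(L ⊗ ℝ)` (★ `contDiff_apply_snd_apply`); right-exp-smoothness through ★ `contDiff_exp_matrix_mixedSpace`.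
* §5 **`chartOrbG_classMul`**: `chartOrbG L α ν′ S′ ((F ∘ bzClassG L α) · a′) c = F (bzClassG L α (gprimeTorus L α S′ c)) · chartOrbG L α ν′ S′ a′ c` at EVERY `c` (the
  integrand on `G′_∞ ⧸ T_{S′}` is `F(cl_G(y γ y⁻¹)) · a′(y γ y⁻¹) = F(cl_G γ) · a′(…)`, ★ `descConj_mk`, `integral_const_mul`); readers **`orbFamG_classMul`** (every label: the
  admissible branch by §5, the junk branch is `0 = F · 0`), **`orbFamGExt_classMul_of_mem_regG`** (★ `orbFamGExt_of_mem_regG`), the chart-coordinate form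
  **`orbFamGExt_classMul_bzClassMapG`** (`= F (bzClassMapG S′ c) · …` on an admissible label, ★ `bzClassG_gprimeTorus`); packaged as the
  (Σ-MULT-G) socket **`exists_archSmooth_orbFamGExt_eq_classMul`** — the `G′`-twin, token for token, of ★ `exists_archSmooth₂_stOrbFamH_eq_classMul`, in the census currency
  `F (bzClassMapG S′ c)`.
* §6 **the STABLE reader** over ★ `stableSumG` (LH10-p02 (g9), N8-INNER (2)): `bzClassMapG_slotPerm` (the class is blind to ★ `partnerPerms`, via ★ `bzClassMapG_update_comp_equiv`),
  **`stableSumG_orbFamGExt_classMul`** (`stableSumG (orbFamGExt … ((F ∘ cl_G) · a′)) S′ c = F (bzClassMapG S′ c) · stableSumG (orbFamGExt … a′) S′ c` on `RegG S′`, admissible `S′`;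
  ★ `slotPerm_mem_regG_iff`), its every-label `ite` form, and the socket **`exists_archSmooth_stableSumG_orbFamGExt_eq_mul`** in the currency of RULING (7)(a).
HONEST LABEL: (Sh)′ ∕ row `stub_N8` stay PRINT-labelled until the N8-INNER junction is ★ and ED. 43 re-keys 27456; HC_CM is proved only modulo the 7 printed citations (2 remaining:
hLiu418 = stmt-HodgeConjecture-24832, h413 = stmt-HodgeConjecture-24833) until rung 0 closes; this file is measure∕calculus plumbing and pays nothing by itself.

## References
* [Bouaziz1994IntegralesOrbitales] A. Bouaziz, *Intégrales orbitales sur les groupes de Lie réductifs*, Ann. Sci. ÉNS (4) 27 (1994) 573–609, §2.3 p. 578, §5.1 p. 588, §6.2 p. 591.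
* [Varadarajan1989] V. S. Varadarajan, *An Introduction to Harmonic Analysis on Semisimple Lie Groups*, Cambridge Stud. Adv. Math. 16 (1989), §6.4 Thms. 22–23 (pp. 189–190).
* [Rogawski1990] J. D. Rogawski, *Automorphic Representations of Unitary Groups in Three Variables*, Ann. of Math. Stud. 123 (1990), §3.6 p. 28, §4.1 (4.1.1) p. 39, §8.2 p. 122.
* [Shelstad1979] D. Shelstad, *Characters and inner forms of a quasi-split group over ℝ*, Compositio Math. 39 (1979), §4 pp. 22–25.
* [BorelJacquet1979] A. Borel, H. Jacquet, *Automorphic forms and automorphic representations*, Proc. Sympos. Pure Math. 33 (1979), part 1, §4.1.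
-/

set_option autoImplicit false

noncomputable section

open MeasureTheory NumberField NumberField.InfinitePlace NumberField.mixedEmbedding Complex Set Function
open Literature.NumberTheory.Automorphic Literature.NumberTheory.Automorphic.UnitaryGroup Literature.NumberTheory.Automorphic.ArchCartan
open Literature.MeasureTheory.Group
open scoped Classical MatrixGroups Matrix ContDiff

namespace Literature.NumberTheory.Rogawski1990

/-! ## §1 The sum of the principal `2 × 2` minors of a `3 × 3` matrix (the second elementary symmetric function of the eigenvalues) -/

section Minor

open Polynomial

variable {R : Type*} [CommRing R]

/-- **`2 · (Σ principal 2×2 minors) = (tr A)² − tr (A²)`** for a `3 × 3` matrix — Newton's identity `2e₂ = p₁² − p₂`; the left side is the entry polynomial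
`A₀₀A₁₁ − A₀₁A₁₀ + A₀₀A₂₂ − A₀₂A₂₀ + A₁₁A₂₂ − A₁₂A₂₁` (the coefficient `e₂` of `det(X − A) = X³ − e₁X² + e₂X − e₃`). [cite: Varadarajan1989, §6.4 Thms. 22–23] -/
theorem two_mul_bzMinorSum (A : Matrix (Fin 3) (Fin 3) R) :
    2 * (A 0 0 * A 1 1 - A 0 1 * A 1 0 + (A 0 0 * A 2 2 - A 0 2 * A 2 0) + (A 1 1 * A 2 2 - A 1 2 * A 2 1)) = A.trace ^ 2 - (A * A).trace := by
  rw [Matrix.trace_fin_three, Matrix.trace_fin_three]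
  simp only [Matrix.mul_apply, Fin.sum_univ_three]
  ring

/-- **The principal-minor sum is a CLASS FUNCTION**: `e₂ (M A M⁻¹) = e₂ A` for `M ∈ GL₃(R)` when `2` is not a zero divisor (here: `R = ℂ`), by `two_mul_bzMinorSum` and the
conjugation invariance of `tr` on `A` and on `A² ` (Mathlib `Matrix.trace_units_conj`). [cite: Varadarajan1989, §6.4 Thms. 22–23] -/
theorem bzMinorSum_units_conj [NoZeroDivisors R] [CharZero R] (M : (Matrix (Fin 3) (Fin 3) R)ˣ) (A : Matrix (Fin 3) (Fin 3) R) :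
    ((M : Matrix (Fin 3) (Fin 3) R) * A * ((M⁻¹ : (Matrix (Fin 3) (Fin 3) R)ˣ) : Matrix (Fin 3) (Fin 3) R)) 0 0 * ((M : Matrix (Fin 3) (Fin 3) R) * A * ((M⁻¹ : (Matrix (Fin 3) (Fin 3) R)ˣ) : Matrix (Fin 3) (Fin 3) R)) 1 1 -
          ((M : Matrix (Fin 3) (Fin 3) R) * A * ((M⁻¹ : (Matrix (Fin 3) (Fin 3) R)ˣ) : Matrix (Fin 3) (Fin 3) R)) 0 1 * ((M : Matrix (Fin 3) (Fin 3) R) * A * ((M⁻¹ : (Matrix (Fin 3) (Fin 3) R)ˣ) : Matrix (Fin 3) (Fin 3) R)) 1 0 +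
        (((M : Matrix (Fin 3) (Fin 3) R) * A * ((M⁻¹ : (Matrix (Fin 3) (Fin 3) R)ˣ) : Matrix (Fin 3) (Fin 3) R)) 0 0 * ((M : Matrix (Fin 3) (Fin 3) R) * A * ((M⁻¹ : (Matrix (Fin 3) (Fin 3) R)ˣ) : Matrix (Fin 3) (Fin 3) R)) 2 2 -
          ((M : Matrix (Fin 3) (Fin 3) R) * A * ((M⁻¹ : (Matrix (Fin 3) (Fin 3) R)ˣ) : Matrix (Fin 3) (Fin 3) R)) 0 2 * ((M : Matrix (Fin 3) (Fin 3) R) * A * ((M⁻¹ : (Matrix (Fin 3) (Fin 3) R)ˣ) : Matrix (Fin 3) (Fin 3) R)) 2 0) +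
        (((M : Matrix (Fin 3) (Fin 3) R) * A * ((M⁻¹ : (Matrix (Fin 3) (Fin 3) R)ˣ) : Matrix (Fin 3) (Fin 3) R)) 1 1 * ((M : Matrix (Fin 3) (Fin 3) R) * A * ((M⁻¹ : (Matrix (Fin 3) (Fin 3) R)ˣ) : Matrix (Fin 3) (Fin 3) R)) 2 2 -
          ((M : Matrix (Fin 3) (Fin 3) R) * A * ((M⁻¹ : (Matrix (Fin 3) (Fin 3) R)ˣ) : Matrix (Fin 3) (Fin 3) R)) 1 2 * ((M : Matrix (Fin 3) (Fin 3) R) * A * ((M⁻¹ : (Matrix (Fin 3) (Fin 3) R)ˣ) : Matrix (Fin 3) (Fin 3) R)) 2 1) =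
      A 0 0 * A 1 1 - A 0 1 * A 1 0 + (A 0 0 * A 2 2 - A 0 2 * A 2 0) + (A 1 1 * A 2 2 - A 1 2 * A 2 1) := by
  have hsq : (M : Matrix (Fin 3) (Fin 3) R) * A * ((M⁻¹ : (Matrix (Fin 3) (Fin 3) R)ˣ) : Matrix (Fin 3) (Fin 3) R) *
        ((M : Matrix (Fin 3) (Fin 3) R) * A * ((M⁻¹ : (Matrix (Fin 3) (Fin 3) R)ˣ) : Matrix (Fin 3) (Fin 3) R)) =
      (M : Matrix (Fin 3) (Fin 3) R) * (A * A) * ((M⁻¹ : (Matrix (Fin 3) (Fin 3) R)ˣ) : Matrix (Fin 3) (Fin 3) R) := by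
    calc (M : Matrix (Fin 3) (Fin 3) R) * A * ((M⁻¹ : (Matrix (Fin 3) (Fin 3) R)ˣ) : Matrix (Fin 3) (Fin 3) R) *
          ((M : Matrix (Fin 3) (Fin 3) R) * A * ((M⁻¹ : (Matrix (Fin 3) (Fin 3) R)ˣ) : Matrix (Fin 3) (Fin 3) R))
        = (M : Matrix (Fin 3) (Fin 3) R) * A * (((M⁻¹ : (Matrix (Fin 3) (Fin 3) R)ˣ) : Matrix (Fin 3) (Fin 3) R) * (M : Matrix (Fin 3) (Fin 3) R)) * A *
            ((M⁻¹ : (Matrix (Fin 3) (Fin 3) R)ˣ) : Matrix (Fin 3) (Fin 3) R) := by simp only [Matrix.mul_assoc]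
      _ = (M : Matrix (Fin 3) (Fin 3) R) * (A * A) * ((M⁻¹ : (Matrix (Fin 3) (Fin 3) R)ˣ) : Matrix (Fin 3) (Fin 3) R) := by
          rw [Units.inv_mul, Matrix.mul_one, Matrix.mul_assoc (M : Matrix (Fin 3) (Fin 3) R) A A]
  have h2 := two_mul_bzMinorSum ((M : Matrix (Fin 3) (Fin 3) R) * A * ((M⁻¹ : (Matrix (Fin 3) (Fin 3) R)ˣ) : Matrix (Fin 3) (Fin 3) R))
  rw [hsq, Matrix.trace_units_conj, Matrix.trace_units_conj, ← two_mul_bzMinorSum A] at h2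
  exact mul_left_cancel₀ two_ne_zero h2

/-- The characteristic polynomial of a `3 × 3` matrix in the `(e₁, e₂, e₃)` normal form `X³ − C(tr A)·X² + C(e₂ A)·X − C(det A)` (★ `charpoly_fin_three_explicit` with the trace and
the determinant folded back by `Matrix.trace_fin_three` ∕ `Matrix.det_fin_three`). [cite: Varadarajan1989, §6.4 Thms. 22–23] -/
private theorem charpoly_eq_cubic_normalForm (A : Matrix (Fin 3) (Fin 3) R) :
    A.charpoly = X ^ 3 - Polynomial.C A.trace * X ^ 2 + Polynomial.C (A 0 0 * A 1 1 - A 0 1 * A 1 0 + (A 0 0 * A 2 2 - A 0 2 * A 2 0) + (A 1 1 * A 2 2 - A 1 2 * A 2 1)) * X -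
      Polynomial.C A.det := by
  rw [Literature.LinearAlgebra.Matrix.charpoly_fin_three_explicit, Matrix.trace_fin_three, Matrix.det_fin_three]
  simp only [map_neg, map_add, map_sub, map_mul]
  ring

/-- The three lower coefficients of a cubic in normal form. [folklore] -/
private theorem coeff_cubic_normalForm (t e d : R) :
    (X ^ 3 - Polynomial.C t * X ^ 2 + Polynomial.C e * X - Polynomial.C d).coeff 2 = -t ∧ (X ^ 3 - Polynomial.C t * X ^ 2 + Polynomial.C e * X - Polynomial.C d).coeff 1 = e ∧
      (X ^ 3 - Polynomial.C t * X ^ 2 + Polynomial.C e * X - Polynomial.C d).coeff 0 = -d := by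
  simp [Polynomial.coeff_C_mul, Polynomial.coeff_C]

end Minor

/-! ## §2 The owner's class map in entry-polynomial form -/

section ClassG

variable (L : Type) [Field L] [NumberField L] [IsCMField L] (α : Fin 3 → L)

/-- **`bzClassG` IS THE ENTRY POLYNOMIAL `(tr, e₂, det)`**: the signed characteristic-polynomial coefficients `(−coeff₂, coeff₁, −coeff₀)` of the place component `A_w` (★
`bzClassG`, LH3-p04's F0) are `(tr A_w, Σ principal 2×2 minors of A_w, det A_w)` (★ `charpoly_fin_three_explicit`).  This is the form in which the class map is visibly a smooth function of
the matrix entries (§4). [cite: Varadarajan1989, §6.4 Thms. 22–23] [cite: Rogawski1990, §3.6 p. 28] -/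
theorem bzClassG_eq_trace_minorSum_det (k : ↥(arch (↥(maximalRealSubfield L)) L (IsCMField.complexConj L) 3 (Matrix.diagonal α))) (w : {w : InfinitePlace L // IsComplex w})
    {A : Matrix (Fin 3) (Fin 3) ℂ} (hA : ((archPiEquivCM 3 L (Matrix.diagonal α) k w : GL (Fin 3) ℂ) : Matrix (Fin 3) (Fin 3) ℂ) = A) :
    bzClassG L α k w = (A.trace, A 0 0 * A 1 1 - A 0 1 * A 1 0 + (A 0 0 * A 2 2 - A 0 2 * A 2 0) + (A 1 1 * A 2 2 - A 1 2 * A 2 1), A.det) := by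
  rw [bzClassG_apply, hA]
  obtain ⟨h2, h1, h0⟩ := coeff_cubic_normalForm A.trace (A 0 0 * A 1 1 - A 0 1 * A 1 0 + (A 0 0 * A 2 2 - A 0 2 * A 2 0) + (A 1 1 * A 2 2 - A 1 2 * A 2 1)) A.det
  rw [charpoly_eq_cubic_normalForm A, h2, h1, h0, neg_neg, neg_neg]

/-- **The class map is constant on conjugacy classes** (`IsConj` form of ★ `bzClassG_conj`). [cite: Bouaziz1994IntegralesOrbitales, §2.3 p. 578] -/
theorem bzClassG_eq_of_isConj {k k' : ↥(arch (↥(maximalRealSubfield L)) L (IsCMField.complexConj L) 3 (Matrix.diagonal α))} (h : IsConj k k') : bzClassG L α k' = bzClassG L α k := by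
  obtain ⟨c, hc⟩ := isConj_iff.1 h
  rw [← hc]
  exact bzClassG_conj L α _ _

/-- The entries of the place component `A_w` of `k` are the `w`-coordinates of the entries of `k ∈ GL₃(L ⊗ ℝ)` (★ `coe_archPiEquivCM_apply`, definitional).
[cite: BorelJacquet1979, §4.1] -/
theorem snd_coe_coe_apply (k : ↥(arch (↥(maximalRealSubfield L)) L (IsCMField.complexConj L) 3 (Matrix.diagonal α))) (w : {w : InfinitePlace L // IsComplex w}) (i j : Fin 3) :
    ((((k : GL (Fin 3) (mixedSpace L)) : Matrix (Fin 3) (Fin 3) (mixedSpace L)) i j).2 w) = ((archPiEquivCM 3 L (Matrix.diagonal α) k w : GL (Fin 3) ℂ) : Matrix (Fin 3) (Fin 3) ℂ) i j :=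
  rfl

/-- **The class map is continuous** (polynomial in the entries of the continuous place components). [cite: Bouaziz1994IntegralesOrbitales, §2.3 p. 578] -/
theorem continuous_bzClassG : Continuous (bzClassG L α) := by
  refine continuous_pi fun w => ?_
  have hA : Continuous fun k : ↥(arch (↥(maximalRealSubfield L)) L (IsCMField.complexConj L) 3 (Matrix.diagonal α)) =>
      ((archPiEquivCM 3 L (Matrix.diagonal α) k w : GL (Fin 3) ℂ) : Matrix (Fin 3) (Fin 3) ℂ) := by
    refine continuous_matrix fun i j => ?_
    have h : (fun k : ↥(arch (↥(maximalRealSubfield L)) L (IsCMField.complexConj L) 3 (Matrix.diagonal α)) => ((archPiEquivCM 3 L (Matrix.diagonal α) k w : GL (Fin 3) ℂ) : Matrix (Fin 3) (Fin 3) ℂ) i j) =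
        fun k : ↥(arch (↥(maximalRealSubfield L)) L (IsCMField.complexConj L) 3 (Matrix.diagonal α)) => ((((k : GL (Fin 3) (mixedSpace L)) : Matrix (Fin 3) (Fin 3) (mixedSpace L)) i j).2 w) :=
      funext fun k => (snd_coe_coe_apply L α k w i j).symm
    rw [h]
    exact (continuous_apply w).comp (continuous_snd.comp ((Units.continuous_val.comp continuous_subtype_val).matrix_elem i j))
  have he : ∀ i j : Fin 3, Continuous fun k : ↥(arch (↥(maximalRealSubfield L)) L (IsCMField.complexConj L) 3 (Matrix.diagonal α)) =>
      ((archPiEquivCM 3 L (Matrix.diagonal α) k w : GL (Fin 3) ℂ) : Matrix (Fin 3) (Fin 3) ℂ) i j := fun i j => hA.matrix_elem i j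
  have h : (fun k : ↥(arch (↥(maximalRealSubfield L)) L (IsCMField.complexConj L) 3 (Matrix.diagonal α)) => bzClassG L α k w) = fun k =>
      ((((archPiEquivCM 3 L (Matrix.diagonal α) k w : GL (Fin 3) ℂ) : Matrix (Fin 3) (Fin 3) ℂ)) 0 0 + (((archPiEquivCM 3 L (Matrix.diagonal α) k w : GL (Fin 3) ℂ) : Matrix (Fin 3) (Fin 3) ℂ)) 1 1 +
          (((archPiEquivCM 3 L (Matrix.diagonal α) k w : GL (Fin 3) ℂ) : Matrix (Fin 3) (Fin 3) ℂ)) 2 2,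
        (((archPiEquivCM 3 L (Matrix.diagonal α) k w : GL (Fin 3) ℂ) : Matrix (Fin 3) (Fin 3) ℂ) 0 0 * ((archPiEquivCM 3 L (Matrix.diagonal α) k w : GL (Fin 3) ℂ) : Matrix (Fin 3) (Fin 3) ℂ) 1 1 -
              ((archPiEquivCM 3 L (Matrix.diagonal α) k w : GL (Fin 3) ℂ) : Matrix (Fin 3) (Fin 3) ℂ) 0 1 * ((archPiEquivCM 3 L (Matrix.diagonal α) k w : GL (Fin 3) ℂ) : Matrix (Fin 3) (Fin 3) ℂ) 1 0 +
            (((archPiEquivCM 3 L (Matrix.diagonal α) k w : GL (Fin 3) ℂ) : Matrix (Fin 3) (Fin 3) ℂ) 0 0 * ((archPiEquivCM 3 L (Matrix.diagonal α) k w : GL (Fin 3) ℂ) : Matrix (Fin 3) (Fin 3) ℂ) 2 2 -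
              ((archPiEquivCM 3 L (Matrix.diagonal α) k w : GL (Fin 3) ℂ) : Matrix (Fin 3) (Fin 3) ℂ) 0 2 * ((archPiEquivCM 3 L (Matrix.diagonal α) k w : GL (Fin 3) ℂ) : Matrix (Fin 3) (Fin 3) ℂ) 2 0) +
            (((archPiEquivCM 3 L (Matrix.diagonal α) k w : GL (Fin 3) ℂ) : Matrix (Fin 3) (Fin 3) ℂ) 1 1 * ((archPiEquivCM 3 L (Matrix.diagonal α) k w : GL (Fin 3) ℂ) : Matrix (Fin 3) (Fin 3) ℂ) 2 2 -
              ((archPiEquivCM 3 L (Matrix.diagonal α) k w : GL (Fin 3) ℂ) : Matrix (Fin 3) (Fin 3) ℂ) 1 2 * ((archPiEquivCM 3 L (Matrix.diagonal α) k w : GL (Fin 3) ℂ) : Matrix (Fin 3) (Fin 3) ℂ) 2 1),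
          (((archPiEquivCM 3 L (Matrix.diagonal α) k w : GL (Fin 3) ℂ) : Matrix (Fin 3) (Fin 3) ℂ)).det)) := by
    funext k; rw [bzClassG_eq_trace_minorSum_det L α k w rfl, Matrix.trace_fin_three]
  rw [h]
  refine (((he 0 0).add (he 1 1)).add (he 2 2)).prodMk ((((((he 0 0).mul (he 1 1)).sub ((he 0 1).mul (he 1 0))).add (((he 0 0).mul (he 2 2)).sub ((he 0 2).mul (he 2 0)))).add
    (((he 1 1).mul (he 2 2)).sub ((he 1 2).mul (he 2 1)))).prodMk ?_)
  exact hA.matrix_det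

end ClassG

/-! ## §4 `C_c^∞(G′_∞)` is stable under multiplication by smooth class functions -/

section Mul

variable (L : Type) [Field L] [NumberField L] [IsCMField L] (α : Fin 3 → L)

-- the scoped `ℓ^∞`-operator norm on `M₃(L ⊗ ℝ)` (the one through which ★ `IsArchSmooth` is defined)
open scoped Matrix.Norms.Operator

set_option backward.isDefEq.respectTransparency false in
/-- **THE CLASS-FUNCTION MULTIPLIER PRESERVES `C_c^∞(G′_∞)`**: for `a′ ∈ ArchSmooth L 3 (diag α)` and `F : (W → ℂ × ℂ × ℂ) → ℂ` of class `C^∞`, the product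
`k ↦ F (bzClassG L α k) · a′ k` is `ArchSmooth L 3 (diag α)`.  Witness on `GL₃(L ⊗ ℝ)`: `(F ∘ cl_amb ∘ val) · φ` with `φ` the witness of `a′`, `Θ` its `C^∞` ambient lift
(★ `exists_contDiff_hasCompactSupport_of_isArchSmooth`) and `cl_amb(X)_w = (e₁, e₂, e₃)((X_{ij})_w)` the same entry polynomials on `M₃(L ⊗ ℝ)` (★ `contDiff_apply_snd_apply`):
continuous, support inside that of `φ`, smooth along `X ↦ y · exp X` (★ `contDiff_exp_matrix_mixedSpace`). [cite: Bouaziz1994IntegralesOrbitales, §2.3 p. 578] [cite: BorelJacquet1979, §4.1] -/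
theorem ArchSmooth.classMul {a' : ↥(arch (↥(maximalRealSubfield L)) L (IsCMField.complexConj L) 3 (Matrix.diagonal α)) → ℂ} (ha' : ArchSmooth L 3 (Matrix.diagonal α) a')
    {F : ({w : InfinitePlace L // IsComplex w} → ℂ × ℂ × ℂ) → ℂ} (hF : ContDiff ℝ ∞ F) :
    ArchSmooth L 3 (Matrix.diagonal α) (fun k => F (bzClassG L α k) * a' k) := by
  obtain ⟨φ, hφc, hφs, hφsm, hφa⟩ := ha'
  obtain ⟨Θ, hΘ, -, -, hΘφ⟩ := exists_contDiff_hasCompactSupport_of_isArchSmooth φ hφs hφsm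
  -- the ambient class map: the same entry polynomials on `M₃(L ⊗ ℝ)`, place by place
  obtain ⟨cl, hcl⟩ : ∃ cl : Matrix (Fin 3) (Fin 3) (mixedSpace L) → ({w : InfinitePlace L // IsComplex w} → ℂ × ℂ × ℂ),
      cl = fun X w => ((X 0 0).2 w + (X 1 1).2 w + (X 2 2).2 w,
        (X 0 0).2 w * (X 1 1).2 w - (X 0 1).2 w * (X 1 0).2 w + ((X 0 0).2 w * (X 2 2).2 w - (X 0 2).2 w * (X 2 0).2 w) + ((X 1 1).2 w * (X 2 2).2 w - (X 1 2).2 w * (X 2 1).2 w),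
        Matrix.det (fun i j : Fin 3 => (X i j).2 w)) := ⟨_, rfl⟩
  have hclC : ContDiff ℝ ∞ cl := by
    rw [hcl]
    refine contDiff_pi.2 fun w => (((contDiff_apply_snd_apply L 0 0 w).add (contDiff_apply_snd_apply L 1 1 w)).add (contDiff_apply_snd_apply L 2 2 w)).prodMk
      ((((((contDiff_apply_snd_apply L 0 0 w).mul (contDiff_apply_snd_apply L 1 1 w)).sub ((contDiff_apply_snd_apply L 0 1 w).mul (contDiff_apply_snd_apply L 1 0 w))).add
        (((contDiff_apply_snd_apply L 0 0 w).mul (contDiff_apply_snd_apply L 2 2 w)).sub ((contDiff_apply_snd_apply L 0 2 w).mul (contDiff_apply_snd_apply L 2 0 w)))).add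
        (((contDiff_apply_snd_apply L 1 1 w).mul (contDiff_apply_snd_apply L 2 2 w)).sub ((contDiff_apply_snd_apply L 1 2 w).mul (contDiff_apply_snd_apply L 2 1 w)))).prodMk ?_)
    -- the determinant of the `w`-coordinates: a polynomial in the nine `C^∞` coordinates
    have h : (fun X : Matrix (Fin 3) (Fin 3) (mixedSpace L) => Matrix.det (fun i j : Fin 3 => (X i j).2 w)) = fun X =>
        (X 0 0).2 w * (X 1 1).2 w * (X 2 2).2 w - (X 0 0).2 w * (X 1 2).2 w * (X 2 1).2 w - (X 0 1).2 w * (X 1 0).2 w * (X 2 2).2 w +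
          (X 0 1).2 w * (X 1 2).2 w * (X 2 0).2 w + (X 0 2).2 w * (X 1 0).2 w * (X 2 1).2 w - (X 0 2).2 w * (X 1 1).2 w * (X 2 0).2 w := by
      funext X; exact Matrix.det_fin_three _
    rw [h]
    exact ((((((contDiff_apply_snd_apply L 0 0 w).mul (contDiff_apply_snd_apply L 1 1 w)).mul (contDiff_apply_snd_apply L 2 2 w)).sub
      (((contDiff_apply_snd_apply L 0 0 w).mul (contDiff_apply_snd_apply L 1 2 w)).mul (contDiff_apply_snd_apply L 2 1 w))).sub
      (((contDiff_apply_snd_apply L 0 1 w).mul (contDiff_apply_snd_apply L 1 0 w)).mul (contDiff_apply_snd_apply L 2 2 w))).add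
      (((contDiff_apply_snd_apply L 0 1 w).mul (contDiff_apply_snd_apply L 1 2 w)).mul (contDiff_apply_snd_apply L 2 0 w))).add
      (((contDiff_apply_snd_apply L 0 2 w).mul (contDiff_apply_snd_apply L 1 0 w)).mul (contDiff_apply_snd_apply L 2 1 w)) |>.sub
      (((contDiff_apply_snd_apply L 0 2 w).mul (contDiff_apply_snd_apply L 1 1 w)).mul (contDiff_apply_snd_apply L 2 0 w))
  -- on `G′_∞` the ambient class map IS `bzClassG`
  have hclass : ∀ k : ↥(arch (↥(maximalRealSubfield L)) L (IsCMField.complexConj L) 3 (Matrix.diagonal α)),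
      cl (((k : GL (Fin 3) (mixedSpace L)) : Matrix (Fin 3) (Fin 3) (mixedSpace L))) = bzClassG L α k := fun k => by
    funext w
    rw [hcl, bzClassG_eq_trace_minorSum_det L α k w rfl, Matrix.trace_fin_three]
    simp only [snd_coe_coe_apply]
  refine ⟨fun g => F (cl (g : Matrix (Fin 3) (Fin 3) (mixedSpace L))) * φ g, ?_, hφs.mul_left, fun y => ?_, fun k => ?_⟩
  · exact (hF.continuous.comp (hclC.continuous.comp Units.continuous_val)).mul hφc
  · -- Mathlib idiom (Mathlib/Algebra/Lie/OfAssociative.lean): the Lie structure on `M₃(L ⊗ ℝ)` through which ★ `archGroupGL` speaks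
    letI : LieRing (Matrix (Fin 3) (Fin 3) (mixedSpace L)) := LieRing.ofAssociativeRing
    letI : LieAlgebra ℝ (Matrix (Fin 3) (Fin 3) (mixedSpace L)) := LieAlgebra.ofAssociativeAlgebra
    show ContDiff ℝ ∞ fun X : (archGroupGL 3 L).lie.toSubmodule =>
      F (cl (((y : GL (Fin 3) (mixedSpace L)) * expGL (X : Matrix (Fin 3) (Fin 3) (mixedSpace L)) : GL (Fin 3) (mixedSpace L)) : Matrix (Fin 3) (Fin 3) (mixedSpace L))) *
        φ ((y : GL (Fin 3) (mixedSpace L)) * expGL (X : Matrix (Fin 3) (Fin 3) (mixedSpace L)))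
    have hval : ContDiff ℝ ∞ fun X : (archGroupGL 3 L).lie.toSubmodule => (X : Matrix (Fin 3) (Fin 3) (mixedSpace L)) := (archGroupGL 3 L).lie.toSubmodule.subtypeL.contDiff
    have h : (fun X : (archGroupGL 3 L).lie.toSubmodule =>
        F (cl (((y : GL (Fin 3) (mixedSpace L)) * expGL (X : Matrix (Fin 3) (Fin 3) (mixedSpace L)) : GL (Fin 3) (mixedSpace L)) : Matrix (Fin 3) (Fin 3) (mixedSpace L))) *
          φ ((y : GL (Fin 3) (mixedSpace L)) * expGL (X : Matrix (Fin 3) (Fin 3) (mixedSpace L)))) =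
        fun X : (archGroupGL 3 L).lie.toSubmodule =>
          F (cl (((y : GL (Fin 3) (mixedSpace L)) : Matrix (Fin 3) (Fin 3) (mixedSpace L)) * NormedSpace.exp (X : Matrix (Fin 3) (Fin 3) (mixedSpace L)))) *
            Θ (((y : GL (Fin 3) (mixedSpace L)) : Matrix (Fin 3) (Fin 3) (mixedSpace L)) * NormedSpace.exp (X : Matrix (Fin 3) (Fin 3) (mixedSpace L))) := by
      funext X; rw [hΘφ, Units.val_mul, coe_expGL]
    rw [h]
    have hexp : ContDiff ℝ ∞ fun X : (archGroupGL 3 L).lie.toSubmodule =>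
        ((y : GL (Fin 3) (mixedSpace L)) : Matrix (Fin 3) (Fin 3) (mixedSpace L)) * NormedSpace.exp (X : Matrix (Fin 3) (Fin 3) (mixedSpace L)) :=
      contDiff_const.mul (contDiff_exp_matrix_mixedSpace.comp hval)
    exact (hF.comp (hclC.comp hexp)).mul (hΘ.comp hexp)
  · show F (bzClassG L α k) * a' k = F (cl ((k : GL (Fin 3) (mixedSpace L)) : Matrix (Fin 3) (Fin 3) (mixedSpace L))) * φ (k : GL (Fin 3) (mixedSpace L))
    rw [hclass, hφa]

end Mul

/-! ## §5 The orbital identity: a class function comes out of the chart orbital functional -/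

section Orb

variable (L : Type) [Field L] [NumberField L] [IsCMField L] (α : Fin 3 → L)
  [MeasurableSpace ↥(arch (↥(maximalRealSubfield L)) L (IsCMField.complexConj L) 3 (Matrix.diagonal α))] [BorelSpace ↥(arch (↥(maximalRealSubfield L)) L (IsCMField.complexConj L) 3 (Matrix.diagonal α))]
  (ν' : Measure ↥(arch (↥(maximalRealSubfield L)) L (IsCMField.complexConj L) 3 (Matrix.diagonal α))) [IsFiniteMeasureOnCompacts ν'] [ν'.IsMulRightInvariant]

/-- **A CLASS FUNCTION COMES OUT OF THE CHART ORBITAL FUNCTIONAL** — `chartOrbG L α ν′ S′ ((F ∘ bzClassG L α) · a′) c = F (bzClassG L α (gprimeTorus L α S′ c)) · chartOrbG L α ν′ S′ a′ c`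
at EVERY coordinate `c`: the integrand on `G′_∞ ⧸ T_{S′}` is `F(cl_G(y γ y⁻¹)) · a′(y γ y⁻¹) = F(cl_G γ) · a′(y γ y⁻¹)` (★ `descConj_mk`, `bzClassG_conj`) with `γ = gprimeTorus L α S′ c`,
and the constant leaves the integral. [cite: Bouaziz1994IntegralesOrbitales, §2.3 p. 578; §5.1 p. 588] [cite: Rogawski1990, §8.2 p. 122] -/
theorem chartOrbG_classMul (S' : Finset {w : InfinitePlace L // IsComplex w}) (a' : ↥(arch (↥(maximalRealSubfield L)) L (IsCMField.complexConj L) 3 (Matrix.diagonal α)) → ℂ)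
    (F : ({w : InfinitePlace L // IsComplex w} → ℂ × ℂ × ℂ) → ℂ) (c : {w : InfinitePlace L // IsComplex w} → Fin 3 → ℝ) :
    chartOrbG L α ν' S' (fun k => F (bzClassG L α k) * a' k) c = F (bzClassG L α (gprimeTorus L α S' c)) * chartOrbG L α ν' S' a' c := by
  rw [chartOrbG_def, chartOrbG_def]
  have hint : descConj (gprimeTorus L α S' c) (chartTorusG L α S') (forall_mem_chartTorusG_comm L α S' c)
        (fun k : ↥(arch (↥(maximalRealSubfield L)) L (IsCMField.complexConj L) 3 (Matrix.diagonal α)) => F (bzClassG L α k) * a' k) =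
      fun y => F (bzClassG L α (gprimeTorus L α S' c)) * descConj (gprimeTorus L α S' c) (chartTorusG L α S') (forall_mem_chartTorusG_comm L α S' c) a' y := by
    funext y
    induction y using QuotientGroup.induction_on with
    | H g => rw [descConj_mk, descConj_mk, bzClassG_conj]
  rw [hint, integral_const_mul]
  ring

/-- **THE ORDINARY ORBITAL FAMILY OF `(F ∘ cl_G) · a′` IS `(F ∘ cl_G ∘ chart) · orbFamG … a′`, ON EVERY LABEL AND AT EVERY COORDINATE** (★ `orbFamG`: on an admissible label the
family is `R′_{S′} · chartOrbG`, on a junk label both sides vanish). [cite: Bouaziz1994IntegralesOrbitales, §5.1 p. 588] [cite: Shelstad1979, §4 p. 22] -/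
theorem orbFamG_classMul (a' : ↥(arch (↥(maximalRealSubfield L)) L (IsCMField.complexConj L) 3 (Matrix.diagonal α)) → ℂ) (F : ({w : InfinitePlace L // IsComplex w} → ℂ × ℂ × ℂ) → ℂ)
    (S' : Finset {w : InfinitePlace L // IsComplex w}) (c : {w : InfinitePlace L // IsComplex w} → Fin 3 → ℝ) :
    orbFamG L α ν' (fun k => F (bzClassG L α k) * a' k) S' c = F (bzClassG L α (gprimeTorus L α S' c)) * orbFamG L α ν' a' S' c := by
  by_cases hS' : ∀ w, w ∈ S' → w ∈ splitChartPlaces L α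
  · rw [orbFamG_apply L α ν' _ hS', orbFamG_apply L α ν' a' hS', chartOrbG_classMul]
    ring
  · rw [orbFamG_of_not L α ν' _ hS', orbFamG_of_not L α ν' a' hS', mul_zero]

/-- **THE WALL-EXTENDED FAMILY OF `(F ∘ cl_G) · a′` IS `(F ∘ cl_G ∘ chart) · orbFamGExt … a′` ON THE `G`-REGULAR SET** (★ `orbFamGExt_of_mem_regG`: there the extended family is the
raw one).  The (Σ4a-G) «class-function multiplier» identity of the (Σ-REG-G) road. [cite: Bouaziz1994IntegralesOrbitales, §5.1 p. 588] [cite: Varadarajan1989, §6.4 Thms. 22–23]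
[cite: Shelstad1979, §4 p. 22] -/
theorem orbFamGExt_classMul_of_mem_regG (a' : ↥(arch (↥(maximalRealSubfield L)) L (IsCMField.complexConj L) 3 (Matrix.diagonal α)) → ℂ)
    (F : ({w : InfinitePlace L // IsComplex w} → ℂ × ℂ × ℂ) → ℂ) (S' : Finset {w : InfinitePlace L // IsComplex w}) {c : {w : InfinitePlace L // IsComplex w} → Fin 3 → ℝ} (hc : c ∈ RegG S') :
    orbFamGExt L α ν' (fun k => F (bzClassG L α k) * a' k) S' c = F (bzClassG L α (gprimeTorus L α S' c)) * orbFamGExt L α ν' a' S' c := by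
  rw [orbFamGExt_of_mem_regG L α ν' _ S' hc, orbFamGExt_of_mem_regG L α ν' a' S' hc, orbFamG_classMul]

/-- **CHART-COORDINATE FORM**: on an ADMISSIBLE label (`S′ ⊆` split-chart places) and a `G`-regular point, the wall-extended family of `(F ∘ cl_G) · a′` is
`F (bzClassMapG S′ c) · orbFamGExt … a′ S′ c` (★ `bzClassG_gprimeTorus`, LH3-p04's F0); on a junk label both families vanish identically (★ `orbFamGExt_of_not_admissible`).  The census
currency of the (Σ-REG-G) organ. [cite: Bouaziz1994IntegralesOrbitales, §5.1 p. 588] [cite: Shelstad1979, §4 p. 22] -/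
theorem orbFamGExt_classMul_bzClassMapG (a' : ↥(arch (↥(maximalRealSubfield L)) L (IsCMField.complexConj L) 3 (Matrix.diagonal α)) → ℂ)
    (F : ({w : InfinitePlace L // IsComplex w} → ℂ × ℂ × ℂ) → ℂ) {S' : Finset {w : InfinitePlace L // IsComplex w}} (hS' : ∀ w, w ∈ S' → w ∈ splitChartPlaces L α)
    {c : {w : InfinitePlace L // IsComplex w} → Fin 3 → ℝ} (hc : c ∈ RegG S') :
    orbFamGExt L α ν' (fun k => F (bzClassG L α k) * a' k) S' c = F (bzClassMapG S' c) * orbFamGExt L α ν' a' S' c := by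
  rw [orbFamGExt_classMul_of_mem_regG L α ν' a' F S' hc, bzClassG_gprimeTorus L α S' hS' c]

/-- **(Σ-MULT-G) SOCKET OF THE (Σ-REG-G) ASSEMBLY** — the `G′`-twin, token for token in group-level currency, of ★ `exists_archSmooth₂_stOrbFamH_eq_classMul`: for `F` smooth on
the class space and `a′ ∈ C_c^∞(G′_∞)` there is `a″ ∈ C_c^∞(G′_∞)` — namely `(F ∘ bzClassG L α) · a′` — with `orbFamGExt L α ν′ a″ S′ c = F (bzClassG L α (gprimeTorus L α S′ c)) ·
orbFamGExt L α ν′ a′ S′ c` at every `G`-regular chart point of every label (Bouaziz's `J_G(χφ) = χ·J_G(φ)` for invariant `χ`). [cite: Bouaziz1994IntegralesOrbitales, §5.1 p. 588]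
[cite: Rogawski1990, §4.1 (4.1.1) p. 39] -/
theorem exists_archSmooth_orbFamGExt_eq_classMul (F : ({w : InfinitePlace L // IsComplex w} → ℂ × ℂ × ℂ) → ℂ) (hF : ContDiff ℝ ∞ F)
    (a' : ↥(arch (↥(maximalRealSubfield L)) L (IsCMField.complexConj L) 3 (Matrix.diagonal α)) → ℂ) (ha' : ArchSmooth L 3 (Matrix.diagonal α) a') :
    ∃ a'' : ↥(arch (↥(maximalRealSubfield L)) L (IsCMField.complexConj L) 3 (Matrix.diagonal α)) → ℂ,
      ArchSmooth L 3 (Matrix.diagonal α) a'' ∧ ∀ (S' : Finset {w : InfinitePlace L // IsComplex w}) (c : {w : InfinitePlace L // IsComplex w} → Fin 3 → ℝ), c ∈ RegG S' →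
        orbFamGExt L α ν' a'' S' c = F (bzClassG L α (gprimeTorus L α S' c)) * orbFamGExt L α ν' a' S' c :=
  ⟨fun k => F (bzClassG L α k) * a' k, ha'.classMul L α hF, fun S' _ hc => orbFamGExt_classMul_of_mem_regG L α ν' a' F S' hc⟩


/-- **(Σ-MULT-G) SOCKET, CENSUS CURRENCY**: for `F` smooth and `a′ ∈ C_c^∞(G′_∞)` there is `a″ ∈ C_c^∞(G′_∞)` with
`orbFamGExt L α ν′ a″ S′ c = F (bzClassMapG S′ c) · orbFamGExt L α ν′ a′ S′ c` at every `G`-regular point of every ADMISSIBLE label (and `orbFamGExt … a″ S′ = 0 = orbFamGExt … a′ S′` on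
the junk labels). [cite: Bouaziz1994IntegralesOrbitales, §5.1 p. 588] [cite: Rogawski1990, §4.1 (4.1.1) p. 39] -/
theorem exists_archSmooth_orbFamGExt_eq_bzClassMapG_mul (F : ({w : InfinitePlace L // IsComplex w} → ℂ × ℂ × ℂ) → ℂ) (hF : ContDiff ℝ ∞ F)
    (a' : ↥(arch (↥(maximalRealSubfield L)) L (IsCMField.complexConj L) 3 (Matrix.diagonal α)) → ℂ) (ha' : ArchSmooth L 3 (Matrix.diagonal α) a') :
    ∃ a'' : ↥(arch (↥(maximalRealSubfield L)) L (IsCMField.complexConj L) 3 (Matrix.diagonal α)) → ℂ,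
      ArchSmooth L 3 (Matrix.diagonal α) a'' ∧
        (∀ (S' : Finset {w : InfinitePlace L // IsComplex w}), (∀ w, w ∈ S' → w ∈ splitChartPlaces L α) →
          ∀ (c : {w : InfinitePlace L // IsComplex w} → Fin 3 → ℝ), c ∈ RegG S' → orbFamGExt L α ν' a'' S' c = F (bzClassMapG S' c) * orbFamGExt L α ν' a' S' c) ∧
        ∀ (S' : Finset {w : InfinitePlace L // IsComplex w}), (¬ ∀ w, w ∈ S' → w ∈ splitChartPlaces L α) → orbFamGExt L α ν' a'' S' = fun _ => 0 :=
  ⟨fun k => F (bzClassG L α k) * a' k, ha'.classMul L α hF, fun _ hS' _ hc => orbFamGExt_classMul_bzClassMapG L α ν' a' F hS' hc,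
    fun S' hS' => orbFamGExt_of_not_admissible L α ν' _ S' hS'⟩

end Orb

/-! ## §6 The stable-family reader: a class function comes out of `stableSumG` -/

section Stable

variable (L : Type) [Field L] [NumberField L] [IsCMField L] (α : Fin 3 → L)
  [MeasurableSpace ↥(arch (↥(maximalRealSubfield L)) L (IsCMField.complexConj L) 3 (Matrix.diagonal α))] [BorelSpace ↥(arch (↥(maximalRealSubfield L)) L (IsCMField.complexConj L) 3 (Matrix.diagonal α))]
  (ν' : Measure ↥(arch (↥(maximalRealSubfield L)) L (IsCMField.complexConj L) 3 (Matrix.diagonal α))) [IsFiniteMeasureOnCompacts ν'] [ν'.IsMulRightInvariant]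

omit [IsCMField L] in
/-- **The chart-level class map is blind to the partner permutations**: `bzClassMapG S′ (slotPerm ρ c) = bzClassMapG S′ c` for `ρ ∈ partnerPerms S′` (identity at the split
places; at a compact place the eigenvalue MULTISET is unchanged — ★ `bzClassMapG_update_comp_equiv`, place by place through ★ `bzClassMapG_congr`). [cite: Shelstad1979, Lemma 4.2 (p. 23)]
[cite: Bouaziz1994IntegralesOrbitales, §5.1 p. 588] -/
theorem bzClassMapG_slotPerm {S' : Finset {w : InfinitePlace L // IsComplex w}} {ρ : {w : InfinitePlace L // IsComplex w} → Equiv.Perm (Fin 3)} (hρ : ρ ∈ partnerPerms S')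
    (c : {w : InfinitePlace L // IsComplex w} → Fin 3 → ℝ) : bzClassMapG S' (slotPerm ρ c) = bzClassMapG S' c := by
  funext w
  by_cases hw : w ∈ S'
  · exact bzClassMapG_congr S' (slotPerm_apply_of_mem hρ hw c)
  · have h1 : slotPerm ρ c w = Function.update c w (c w ∘ ρ w) w := by
      funext i; rw [slotPerm_apply, Function.update_self, Function.comp_apply]
    rw [bzClassMapG_congr S' h1]
    exact congrFun (bzClassMapG_update_comp_equiv S' hw c (ρ w)) w

/-- **A CLASS FUNCTION COMES OUT OF THE STABLE SUM**: on an admissible label and a `G`-regular point,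
`stableSumG (orbFamGExt L α ν′ ((F ∘ bzClassG L α) · a′)) S′ c = F (bzClassMapG S′ c) · stableSumG (orbFamGExt L α ν′ a′) S′ c` — every partner point `slotPerm ρ c` is `G`-regular
(★ `slotPerm_mem_regG_iff`) with the same class (`bzClassMapG_slotPerm`), so `F (bzClassMapG S′ c)` factors out of ★ `stableSumG` term by term.  The stable twin of
`orbFamGExt_classMul_bzClassMapG`; Bouaziz's `J^st_G(χφ) = χ · J^st_G(φ)`. [cite: Bouaziz1994IntegralesOrbitales, §5.1 p. 588; §6.2 p. 591] [cite: Shelstad1979, Lemma 4.2 (p. 23)]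
[cite: Rogawski1990, §4.1 (4.1.1) p. 39] -/
theorem stableSumG_orbFamGExt_classMul (a' : ↥(arch (↥(maximalRealSubfield L)) L (IsCMField.complexConj L) 3 (Matrix.diagonal α)) → ℂ)
    (F : ({w : InfinitePlace L // IsComplex w} → ℂ × ℂ × ℂ) → ℂ) {S' : Finset {w : InfinitePlace L // IsComplex w}} (hS' : ∀ w, w ∈ S' → w ∈ splitChartPlaces L α)
    {c : {w : InfinitePlace L // IsComplex w} → Fin 3 → ℝ} (hc : c ∈ RegG S') :
    stableSumG (orbFamGExt L α ν' (fun k => F (bzClassG L α k) * a' k)) S' c = F (bzClassMapG S' c) * stableSumG (orbFamGExt L α ν' a') S' c := by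
  rw [stableSumG_apply, stableSumG_apply, Finset.mul_sum]
  refine Finset.sum_congr rfl fun ρ hρ => ?_
  rw [orbFamGExt_classMul_bzClassMapG L α ν' a' F hS' ((slotPerm_mem_regG_iff hρ c).2 hc), bzClassMapG_slotPerm L hρ c]
  ring

/-- The same on EVERY label at a `G`-regular point: admissible ⇒ the class function factors out; junk ⇒ both stable sums vanish (★ `orbFamGExt_of_not_admissible`).
[cite: Bouaziz1994IntegralesOrbitales, §5.1 p. 588] -/
theorem stableSumG_orbFamGExt_classMul_eq_ite (a' : ↥(arch (↥(maximalRealSubfield L)) L (IsCMField.complexConj L) 3 (Matrix.diagonal α)) → ℂ)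
    (F : ({w : InfinitePlace L // IsComplex w} → ℂ × ℂ × ℂ) → ℂ) (S' : Finset {w : InfinitePlace L // IsComplex w})
    {c : {w : InfinitePlace L // IsComplex w} → Fin 3 → ℝ} (hc : c ∈ RegG S') :
    stableSumG (orbFamGExt L α ν' (fun k => F (bzClassG L α k) * a' k)) S' c =
      (if ∀ w, w ∈ S' → w ∈ splitChartPlaces L α then F (bzClassMapG S' c) else 0) * stableSumG (orbFamGExt L α ν' a') S' c := by
  by_cases hS' : ∀ w, w ∈ S' → w ∈ splitChartPlaces L α
  · rw [if_pos hS', stableSumG_orbFamGExt_classMul L α ν' a' F hS' hc]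
  · rw [if_neg hS', zero_mul, stableSumG_apply]
    refine Finset.sum_eq_zero fun ρ _ => ?_
    rw [orbFamGExt_of_not_admissible L α ν' _ S' hS', mul_zero]

/-- **(Σ-MULT-G) SOCKET, STABLE FORM** (the currency of RULING (7)(a): `stableSumG (orbFamGExt L β ν a) S′ c`): for `F` smooth and `a′ ∈ C_c^∞(G′_∞)` there is `a″ ∈ C_c^∞(G′_∞)` — namely
`(F ∘ bzClassG L α) · a′` — whose STABLE wall-extended family is `F (bzClassMapG S′ c) · stableSumG (orbFamGExt L α ν′ a′) S′ c` at every `G`-regular point of every admissible label.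
[cite: Bouaziz1994IntegralesOrbitales, §5.1 p. 588; §6.2 p. 591] [cite: Rogawski1990, §4.1 (4.1.1) p. 39] -/
theorem exists_archSmooth_stableSumG_orbFamGExt_eq_mul (F : ({w : InfinitePlace L // IsComplex w} → ℂ × ℂ × ℂ) → ℂ) (hF : ContDiff ℝ ∞ F)
    (a' : ↥(arch (↥(maximalRealSubfield L)) L (IsCMField.complexConj L) 3 (Matrix.diagonal α)) → ℂ) (ha' : ArchSmooth L 3 (Matrix.diagonal α) a') :
    ∃ a'' : ↥(arch (↥(maximalRealSubfield L)) L (IsCMField.complexConj L) 3 (Matrix.diagonal α)) → ℂ,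
      ArchSmooth L 3 (Matrix.diagonal α) a'' ∧
        ∀ (S' : Finset {w : InfinitePlace L // IsComplex w}), (∀ w, w ∈ S' → w ∈ splitChartPlaces L α) →
          ∀ (c : {w : InfinitePlace L // IsComplex w} → Fin 3 → ℝ), c ∈ RegG S' →
            stableSumG (orbFamGExt L α ν' a'') S' c = F (bzClassMapG S' c) * stableSumG (orbFamGExt L α ν' a') S' c :=
  ⟨fun k => F (bzClassG L α k) * a' k, ha'.classMul L α hF, fun _ hS' _ hc => stableSumG_orbFamGExt_classMul L α ν' a' F hS' hc⟩

end Stable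

end Literature.NumberTheory.Rogawski1990

end
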